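import Summits.Ventures.PercRepro.ProfileThreeFourLine
import Summits.Ventures.PercRepro.C025ProfileStagedLine3Thm

/-!
# THE ROW `(3,4)` OF `(Π)` FOR EVERY FINITE MATROID (night-3 g12 + p10 g6, 2026-08-25)
p10's reduction `profileIneq_three_four_of_short_lines_rank_ge_five` (Theorem A: the row `q = 3` lifts over every point of a
`≥ 4`-point line; loops and parallel pairs by the simple reduction; ranks `≤ 4` by the empty / top levels) composed with
night-3's Theorem L3 (`profileIneq_three_four_line3'`: the staged certificate is a certificate on every simple matroid of rank
`≥ 5` with all lines `≤ 3` points).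
-/
open scoped Matroid
namespace PercRepro
open Set Finset ThmH

variable {α : Type} [DecidableEq α]

/-- **THE ROW `(3,4)` OF THE PROFILE INEQUALITY `(Π)` FOR EVERY FINITE MATROID**:
`4 · #{S : ρ(S) = 4} ≥ Σ_{B : ρ(B) = 3, ρ(E∖B) ≥ 4} ρ(E∖B)`. -/
theorem profileIneq_three_four (M : Matroid α) [M.Finite] : Profile.ProfileIneq M 3 4 := by
  apply Cogirth.profileIneq_three_four_of_short_lines_rank_ge_five
  intro N _ hs hlines hge5
  have hsimple : ∀ X ⊆ gr N, X.card = 2 → Staged.rkN N X = 2 := by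
    intro X hXg hX2
    have hind := hs X hXg (by rw [hX2])
    have henc : (X : Set α).encard = 2 := by rw [Set.encard_coe_eq_coe_finsetCard, hX2]; rfl
    rw [Staged.rkN_eq_iff, hind.eRk_eq_encard, henc]; rfl
  have h3line : ∀ X ⊆ gr N, Staged.rkN N X ≤ 2 → X.card ≤ 3 := by
    intro X hXg hX
    rcases Nat.lt_or_ge (Staged.rkN N X) 2 with hlt | hge
    · have h1 := Staged.card_le_one_of_rkN_le_one hsimple hXg (by omega)
      omega
    · have h2 : Staged.rkN N X = 2 := by omega
      exact hlines X hXg h2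
  have hR : (5 : ℕ∞) ≤ N.eRank := by
    have h1 : Staged.rkN N (gr N) = N.eRank.toNat := Staged.rkN_gr_eq
    have h2 : Staged.rkN N (gr N) = Skew.rk N (gr N) := rfl
    have hRtop : N.eRank ≠ ⊤ := N.eRank_ne_top_iff.2 inferInstance
    have h5 : 5 ≤ N.eRank.toNat := by omega
    have := ENat.coe_toNat hRtop
    rw [← this]
    exact_mod_cast h5
  exact Staged.profileIneq_three_four_line3 hsimple h3line hR

end PercRepro
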